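import Literature.Computability.Cryptography.LWEHardness
import Literature.Computability.Cryptography.QuantumCircuitProofs
import Literature.Computability.Cryptography.DiscretizedGaussianMass
import Literature.Computability.Cryptography.LWESearchToDecisionAnalysis
import Literature.Computability.Cryptography.LWESearchToDecisionMachine
import Mathlib.Analysis.SpecialFunctions.Trigonometric.Bounds
import HarnessLib

/-!
# Hardness of Learning With Errors — discharged facts

Proofs of named facts stated in `Literature.Computability.Cryptography.LWEHardness`, kept in a
sibling file so that the statement file keeps its imports (this file additionally imports the G11
discharges of `Literature.Computability.Cryptography.QuantumCircuitProofs`):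

* `UniformQCircuitFamily.family_isPolySize_holds` discharges
  `UniformQCircuitFamily.family_isPolySize`: every polynomial-time uniform quantum circuit family
  (the bundled structure `UniformQCircuitFamily` = a Clifford+T `QCircuitFamily` with
  `IsOracleFree` and `IsUniform`) has polynomial size, gates AND ancillas. The proof feeds the
  field `isUniform` to the discharged G11 fact `QCircuitFamily.IsUniform.isPolySize`
  (`QCircuitFamily.IsUniform.isPolySize_holds`): the uniformity machine halts within `p(n)` steps
  on `1ⁿ`, hence writes a description of at most `n + D·p(n)` symbols, while the description
  `QCircuit.sigmaEncode ⟨n, m, C⟩` is at least `C.size + m` bits long (two bits per gate, unary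
  ancilla count).

* `regev_search_to_decision_holds` discharges **pqc.S22, easy direction**
  `regev_search_to_decision` (search ⇒ decision for `LWE_{q,Ψ̄_α}`, `q ≥ 2` polynomially
  bounded, `α ∈ (0,1)`): Regev 2009, §1, p. 4 ("being able to distinguish [LWE samples] from
  [uniform ones] is equivalent to solving LWE"; only the hard direction, Lemmas 4.1–4.2, is printed
  in §4 — the easy one is folklore and is proved here from scratch). The witness is the one-query
  machine `S2D.s2dAlg` of `LWESearchToDecisionMachine.lean` (no coins, two rounds, `m' = m + 1`
  samples): query the search oracle on the last `m` samples, accept iff the residual of the first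
  sample against the decoded answer vanishes. By `LWESearchToDecisionAnalysis.lean` its advantage
  is `≥ (Ψ̄_α(0) - 1/q) · Pr[oracle solves] ≥ (Ψ̄_α(0) - 1/q) · 2/3`, the wrong-answer case being
  harmless because `Ψ̄_α(H) ≥ |H|/q` for every subgroup `H ≤ ℤ_q`; and by
  `DiscretizedGaussianMass.lean` (Jacobi's transformation formula and a Leibniz bound)
  `Ψ̄_α(0) - 1/q ≥ (4/(3π)) sin(π/q) e^{-πα²} ≥ (8 e^{-π}/(3π))/q`, which is `≥ 1/n^c` eventually
  since `q` is polynomially bounded (Jordan's inequality `sin x ≥ 2x/π`).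

The remaining `def … : Prop`s of `LWEHardness` are the open problems `LWENotInBQP`/`LWEInBQP`,
the Regev/Peikert/BLPRS worst-case reductions and the hard direction `regev_decision_to_search`
(named facts, not attempted here).

## References

* O. Regev, *On lattices, learning with errors, random linear codes, and cryptography*, J. ACM 56
  (2009), art. 34, doi:10.1145/1568318.1568324; arXiv:2401.03703 (read: §1 p. 4, §2, §4 p. 23).
* A. C.-C. Yao, *Quantum circuit complexity*, Proc. 34th IEEE FOCS (1993), 352–361,
  doi:10.1109/SFCS.1993.366852 — uniform polynomial-size quantum circuit families; the source
  cited at the fact. Not held (acquisition request acq-00326 of the G11 discharge); the argument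
  formalised is the textbook one of the next item.
* S. Arora, B. Barak, *Computational Complexity: A Modern Approach*, CUP 2009,
  doi:10.1017/cbo9780511804090: Def. 6.12 and Thm. 6.13 with its proof sketch, book pp. 111–112 =
  PDF pp. 140–141 of the held copy (**P**-uniform family: "a polynomial-time TM that on input `1ⁿ`
  outputs the description of the circuit `C_n`"; proof sketch: "run `M(1^{|x|})` to obtain the
  circuit `C_{|x|}`", a polynomial-time computation); §10.3.5, Def. 10.9, PDF p. 255 (BQP: a
  polynomial-time TM writes the gate descriptions `F_1, …, F_T`, register of `m ≤ T(n)` qubits).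
* M. A. Nielsen, I. L. Chuang, *Quantum Computation and Quantum Information*, CUP 2010, §4.5.5
  (BQP through uniformly generated polynomial-size quantum circuit families).
-/

namespace Literature.Computability.Cryptography

namespace UniformQCircuitFamily

/-- **Discharge of `UniformQCircuitFamily.family_isPolySize`.** Every polynomial-time uniform
quantum circuit family `Q : UniformQCircuitFamily` is polynomial-size (`Q.family.IsPolySize`):
one polynomial `p` bounds both `(Q.family.circ n).size` and `Q.family.ancillas n` for all `n`.
Proof: the uniformity field `Q.isUniform` fed to the discharged G11 fact
`QCircuitFamily.IsUniform.isPolySize` (`QCircuitFamily.IsUniform.isPolySize_holds`, applied form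
`IsUniform.isPolySize'`): a machine halting within `p(n)` steps on `1ⁿ` writes at most
`n + D·p(n)` output symbols, and `QCircuit.sigmaEncode ⟨n, m, C⟩` has length `≥ C.size + m`. This
is the observation behind Arora–Barak, Def. 6.12 and the proof sketch of Thm. 6.13, book
pp. 111–112 (a **P**-uniform family is printed by "a polynomial-time TM that on input `1ⁿ`
outputs the description of the circuit `C_n`", so obtaining `C_{|x|}` is a polynomial-time, hence
polynomial-output, computation) and §10.3.5, Def. 10.9 (BQP: `T(n)` gate descriptions written
by a polynomial-time TM, `m ≤ T(n)` qubits), after Yao 1993 (uniform polynomial-size quantum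
circuit families). [cite: AroraBarak2009, Def. 6.12 & Thm. 6.13 (proof) pp. 111–112] -/
theorem family_isPolySize_holds : family_isPolySize := fun Q =>
  Q.isUniform.isPolySize'

end UniformQCircuitFamily


/-! ### pqc.S22, easy direction: search ⇒ decision -/

section SearchDecision

open Filter LWE Complexity

variable (q : ℕ → ℕ) [∀ n, NeZero (q n)]

/-- **Discharge of `regev_search_to_decision` (pqc.S22, easy direction).** For `q ≥ 2`
polynomially bounded, `α(n) ∈ (0,1)` eventually and any `m`, the one-query machine `S2D.s2dAlg`
(coins `0`, fuel `2`, `m' = m + 1` samples, exponent `c = k + 2` where `q ≤ C n^k + C`) turns every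
oracle solving search-`LWE_{q,Ψ̄_α}` from `m` samples with probability `≥ 2/3` into a decision-LWE
distinguisher with advantage `≥ 1/n^c` for all large `n`. Proof: `S2D.oracleLWEDistinguisher_s2dAlg`
identifies the distinguisher with the Dirac kernel of the zero-residual test;
`distinguishingAdvantage_zeroResidual_ge` (with the subgroup bound
`discretizedGaussian_sum_addSubgroup_ge`) bounds the advantage below by `(Ψ̄_α(0) - 1/q) · 2/3`;
`discretizedGaussian_zero_toReal_ge`, Jordan's inequality and `e^{-πα²} ≥ e^{-π}` give
`Ψ̄_α(0) - 1/q ≥ 8 e^{-π}/(3π q)`, and `q ≤ 2C n^k ≤ (16 e^{-π}/(9π)) n^{k+2}` for large `n`.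
(Regev 2009, §1, p. 4: search/decision equivalence, easy direction; the printed §4 proves only
decision ⇒ search, Lemmas 4.1–4.2.) [cite: RegevLWE2009, §1 p. 4 (arXiv:2401.03703); §4 Lemmas 4.1–4.2 for context] -/
theorem regev_search_to_decision_holds : regev_search_to_decision q := by
  intro α m hq hq2 hm hα
  obtain ⟨P, hP⟩ := hq
  obtain ⟨C, k, hCk⟩ := exists_eval_le_mul_pow_add P
  refine ⟨S2D.s2dAlg, 0, Polynomial.C 2, fun n => m n + 1, k + 2, S2D.s2dAlg_isPolyTime, ?_, ?_⟩
  · obtain ⟨Pm, hPm⟩ := hm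
    exact ⟨Pm + 1, fun n => by simpa using hPm n⟩
  · intro O hO
    -- the constant `K = 16 e^{-π} / (9π)` of the final bound
    set K : ℝ := 16 * Real.exp (-Real.pi) / (9 * Real.pi) with hKdef
    have hK : 0 < K := by positivity
    have hKn : ∀ᶠ n : ℕ in atTop, (2 * C : ℝ) ≤ K * (n : ℝ) ^ 2 :=
      (((tendsto_pow_atTop two_ne_zero).comp tendsto_natCast_atTop_atTop).const_mul_atTop hK)
        |>.eventually_ge_atTop _
    rw [Oracle.solvesSearchLWE_iff] at hO
    simp only [DecisionLWEDistinguishes]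
    filter_upwards [hO, hq2, hα, hKn, eventually_ge_atTop 1] with n hsucc hqn hαn hKn2 hn1
    -- the solver judged by `SolvesSearchLWE` and the distinguisher presented by the machine
    set F : (Fin (m n) → (Fin n → ZMod (q n)) × ZMod (q n)) → (Fin n → ZMod (q n)) :=
      fun t => decodeSecret n (q n) (O (encodeLWESamples t)) with hF
    have hker : O.searchLWEKernel n (q n) (m n) = fun t => PMF.pure (F t) := rfl
    have hD : oracleLWEDistinguisher S2D.s2dAlg O 0 (Polynomial.C 2) n (q n) (m n + 1) =
        zeroResidualDistinguisher F := by
      funext S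
      rw [S2D.oracleLWEDistinguisher_s2dAlg]
      rfl
    rw [hker] at hsucc
    rw [hD]
    -- the probabilistic analysis
    have hχ := fun (H : AddSubgroup (ZMod (q n))) (T : Finset (ZMod (q n))) (hT : ∀ x, x ∈ T ↔ x ∈ H) =>
      discretizedGaussian_sum_addSubgroup_ge hαn.1 H T hT
    have hadv := distinguishingAdvantage_zeroResidual_ge (discretizedGaussian (q n) (α n)) hχ (m n) F
    -- the success probability is at least `2/3`
    have hsuccR : (2 : ℝ) / 3 ≤ (searchSuccessProb (discretizedGaussian (q n) (α n)) (m n)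
        fun t => PMF.pure (F t)).toReal :=
      (ENNReal.ofReal_le_iff_le_toReal (ne_top_of_le_ne_top ENNReal.one_ne_top
        (searchSuccessProb_le_one_holds _ _ _))).1 hsucc
    -- the mass at zero
    have hq0 : (0 : ℝ) < q n := by exact_mod_cast Nat.pos_of_ne_zero (NeZero.ne (q n))
    have hq2' : (2 : ℝ) ≤ q n := by exact_mod_cast hqn
    have hmass := discretizedGaussian_zero_toReal_ge (p := q n) hαn.1 hqn
    have hsin : 2 / (q n : ℝ) ≤ Real.sin (Real.pi / q n) := by
      have h := Real.mul_le_sin (x := Real.pi / q n) (by positivity) (by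
        rw [div_le_div_iff₀ hq0 (by norm_num : (0 : ℝ) < 2)]
        nlinarith [Real.pi_pos])
      calc 2 / (q n : ℝ) = 2 / Real.pi * (Real.pi / q n) := by field_simp
        _ ≤ _ := h
    have hexp : Real.exp (-Real.pi) ≤ Real.exp (-Real.pi * α n ^ 2) := by
      rw [Real.exp_le_exp]
      have : α n ^ 2 ≤ 1 := by nlinarith [hαn.1, hαn.2]
      nlinarith [Real.pi_pos]
    have hgap : 8 * Real.exp (-Real.pi) / (3 * Real.pi) / q n ≤
        ((discretizedGaussian (q n) (α n)) 0).toReal - 1 / q n := by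
      have h1 : 8 * Real.exp (-Real.pi) / (3 * Real.pi) / q n =
          4 / (3 * Real.pi) * (2 / q n) * Real.exp (-Real.pi) := by field_simp; ring
      rw [h1]
      have h2 : 4 / (3 * Real.pi) * (2 / q n) * Real.exp (-Real.pi) ≤
          4 / (3 * Real.pi) * Real.sin (Real.pi / q n) * Real.exp (-Real.pi * α n ^ 2) :=
        mul_le_mul (mul_le_mul_of_nonneg_left hsin (by positivity)) hexp (Real.exp_pos _).le
          (mul_nonneg (by positivity) ((by positivity : (0:ℝ) ≤ 2 / q n).trans hsin))
      linarith
    -- assemble: advantage ≥ K / q n ≥ 1 / n^(k+2)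
    have hK' : K / q n ≤ distinguishingAdvantage (discretizedGaussian (q n) (α n)) (m n + 1)
        (zeroResidualDistinguisher F) := by
      refine le_trans ?_ hadv
      have hg0 : 0 ≤ 8 * Real.exp (-Real.pi) / (3 * Real.pi) / q n := by positivity
      calc K / q n = 8 * Real.exp (-Real.pi) / (3 * Real.pi) / q n * (2 / 3) := by
            rw [hKdef]; field_simp; ring
        _ ≤ (((discretizedGaussian (q n) (α n)) 0).toReal - 1 / q n) * (2 / 3) :=
            mul_le_mul_of_nonneg_right hgap (by norm_num)
        _ ≤ _ := mul_le_mul_of_nonneg_left hsuccR (hg0.trans hgap)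
    refine le_trans ?_ hK'
    have hn0 : (0 : ℝ) < n := by exact_mod_cast hn1
    have hqC : (q n : ℝ) ≤ 2 * C * (n : ℝ) ^ k := by
      have h1 : (q n : ℝ) ≤ C * (n : ℝ) ^ k + C := by exact_mod_cast (hP n).trans (hCk n)
      have h2 : (1 : ℝ) ≤ (n : ℝ) ^ k := one_le_pow₀ (by exact_mod_cast hn1)
      have hC : (0 : ℝ) ≤ C := Nat.cast_nonneg C
      nlinarith
    rw [div_le_div_iff₀ (by positivity) hq0, one_mul]
    calc (q n : ℝ) ≤ 2 * C * (n : ℝ) ^ k := hqC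
      _ ≤ K * (n : ℝ) ^ 2 * (n : ℝ) ^ k := mul_le_mul_of_nonneg_right hKn2 (by positivity)
      _ = K * (n : ℝ) ^ (k + 2) := by ring

end SearchDecision

end Literature.Computability.Cryptography
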